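/-
Copyright (c) 2026 the pub-hodgecm-mathlib formalisation cell (harness21).  Prover seat hodgecm-mathlib-K2Liu-p05 (g4), 2026-09-04
(Track B «K2-LIT», crux hLiu418 = stmt-HodgeConjecture-24832, LEAD F0P6-plan (g13) RULING M-157m (1) organ (SD-1-ind), file (IV-b):
for `χ = χ_k` and `U(2,2)`, `f(w·n(x))·e(−tr hx)` is a FINITE sum of POLYNOMIAL moments of Shimura's `ξ`-integrands at integer-shifted parameters).
-/
import Summits.HodgeConjecture.HodgeConjecture.Theorems.K2LiuKFiniteSectionAtWeylTranslate        -- ★ (SD-1-ind) (III)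
import Summits.HodgeConjecture.HodgeConjecture.Theorems.K2LiuInverseLettersCofactorExpansion    -- ★ (SD-1-ind) (IV-a)
import Summits.HodgeConjecture.HodgeConjecture.Theorems.K2LiuHermTwoConfluentXiDefs              -- ★ Φ6b-1 (K2E5-p16): `xiTwoIntegrand`, `hermTwo`
import HarnessLib

/-!
# (SD-1-ind, IV-b) A `K_w`-finite weight-`k` section at the Weyl translate, against the character, = Σ polynomial moments of `ξ`-integrands

Track B ∕ K2-LIT, hLiu418 = stmt-HodgeConjecture-24832; LEAD F0P6-plan (g13) RULING M-157m (1).  Namespace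
`Summit.HodgeConjecture.HodgeConjecture.Cruxes.HLiu418.K2LiuKFiniteSectionXiIntegrandMoments`.  THEOREMS ONLY; `--supports stmt-HodgeConjecture-24832 --as helper`.

* §1 (generic `l`) THE MODULUS IN `ξ`-LETTERS (`modulus_eq`): for hermitian `b` with `arg det(1 − ib) ≠ π` (automatic for `l = 2`, §2) and
  `χ_k(z) = (z̄∕‖z‖)^k` (K2Liu-p11 (g0)'s ★ weight-`k` character), `a = (1 − ib)⁻¹`:
  `χ_k(det a) · ‖det a‖^{2s + l} = det(1 − ib)^{−(s + l∕2 − k∕2)} · det(1 + ib)^{−(s + l∕2 + k∕2)}` (principal powers; `det(1 + ib) = conj det(1 − ib)`).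
* §2 (`l = Fin 2`, chart `x = hermTwo c`) `arg_det_one_sub_I_smul_hermTwo_ne_pi`: `det(1 − ix) = (1 − ab + |z|²) − i(a + b)` is never in `(−∞, 0)`.
* §3 THE MOMENT EXPANSION (`exists_xiTwoIntegrand_moments`): for a Siegel section `f` of `I_w(s, χ_k)` on `U(2,2)` whose restriction to `K_w` is polynomial
  in the entries and their conjugates (★ F2 face BY VALUE, as in ★ (III)), and every `h`, there are finitely many polynomials `P_d ∈ ℂ[x_{jk}]` and shifts
  `m_d, n_d ∈ ℕ` with, for every `c : ℝ × ℂ × ℝ` (`x = hermTwo c`),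
  `f (J · transl x) · e(−tr(h x)) = Σ_d P_d(x_{jk}) · xiTwoIntegrand 1 h (s + 1 − k∕2 + m_d) (s + 1 + k∕2 + n_d) c`
  (★ (III) + §1 + ★ (IV-a) + ★ `xiTwoIntegrand_eq`; the branch constants `e^{iπ(β−α)}` are absorbed into `P_d`).  Integrating over `c` ((V), with
  (SD-2)) makes the Whittaker coefficient `W_h(s; f)` a finite combination of polynomial moments — i.e. parameter DERIVATIVES — of Shimura's `ξ(1, h; ·, ·)`.

HONEST LABEL: HC_CM is proved only modulo the 7 printed citations (2 remaining named inputs: hLiu418 = stmt-HodgeConjecture-24832, h413 =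
stmt-HodgeConjecture-24833) until rung 0 closes; organ capital, moves no counter.

## References
[Shimura1997] G. Shimura, *Euler Products and Eisenstein Series*, CBMS 93 (1997), §16 · [Shimura1982] = G. Shimura, *Confluent hypergeometric functions on
tube domains*, Math. Ann. 260 (1982), (1.25), §3 (cited for orientation; bib key `Shimura1997` only).
-/

set_option autoImplicit false
set_option linter.dupNamespace false

noncomputable section

open scoped Matrix ComplexConjugate ComplexOrder MatrixOrder
open Complex Matrix
open Literature.NumberTheory.ModularForms.SiegelUpperHalfSpace (moeb)
open Summit.HodgeConjecture.HodgeConjecture.Cruxes.HLiu418.K2LiuHermitianTubeCocycle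
open Summit.HodgeConjecture.HodgeConjecture.Cruxes.HLiu418.K2LiuWeylTranslateIwasawa
open Summit.HodgeConjecture.HodgeConjecture.Cruxes.HLiu418.K2LiuKFiniteSectionAtWeylTranslate
open Summit.HodgeConjecture.HodgeConjecture.Cruxes.HLiu418.K2LiuInverseLettersCofactorExpansion
open Summit.HodgeConjecture.HodgeConjecture.Cruxes.HLiu418.K2LiuHermTwoGammaDefs
open Summit.HodgeConjecture.HodgeConjecture.Cruxes.HLiu418.K2LiuHermTwoConfluentXiDefs

namespace Summit.HodgeConjecture.HodgeConjecture.Cruxes.HLiu418.K2LiuKFiniteSectionXiIntegrandMoments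

/-! ## §1 The weight-`k` modulus in `ξ`-letters (generic `l`) -/

/-- the scalar identity: for `z ≠ 0` off the negative real axis, `(conj z⁻¹ ∕ ‖z⁻¹‖)^k · ‖z⁻¹‖^{2s + c} = z^{−(s + c∕2 − k∕2)} · (conj z)^{−(s + c∕2 + k∕2)}`
(both sides `= e^{ikθ − (2s+c) log‖z‖}`, `θ = arg z`). [folklore] -/
theorem conj_inv_div_norm_zpow_mul_norm_cpow {z : ℂ} (hz : z ≠ 0) (harg : z.arg ≠ Real.pi) (k : ℤ) (s c : ℂ) :
    (conj z⁻¹ / ((‖z⁻¹‖ : ℝ) : ℂ)) ^ k * (((‖z⁻¹‖ : ℝ) : ℂ)) ^ (2 * s + c) =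
      z ^ (-(s + c / 2 - k / 2)) * (conj z) ^ (-(s + c / 2 + k / 2)) := by
  have hn : (‖z‖ : ℂ) ≠ 0 := by exact_mod_cast (norm_pos_iff.2 hz).ne'
  have hzc : conj z ≠ 0 := (map_ne_zero _).2 hz
  have hninv : ((‖z⁻¹‖ : ℝ) : ℂ) ≠ 0 := by exact_mod_cast (norm_pos_iff.2 (inv_ne_zero hz)).ne'
  -- `conj z⁻¹ ∕ ‖z⁻¹‖ = z ∕ ‖z‖ = e^{iθ}`
  have h1 : conj z⁻¹ / ((‖z⁻¹‖ : ℝ) : ℂ) = cexp ((z.arg : ℂ) * I) := by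
    have hpolar : ((‖z‖ : ℝ) : ℂ) * cexp ((z.arg : ℂ) * I) = z := norm_mul_exp_arg_mul_I z
    rw [map_inv₀, norm_inv, Complex.ofReal_inv, inv_div_inv, div_eq_iff hzc, ← mul_right_inj' hn, ← mul_assoc, hpolar, Complex.mul_conj,
      Complex.normSq_eq_norm_sq]
    push_cast
    ring
  -- `‖z⁻¹‖^{w} = e^{−w log ‖z‖}`
  have h2 : (((‖z⁻¹‖ : ℝ) : ℂ)) ^ (2 * s + c) = cexp (-((Real.log ‖z‖ : ℝ) : ℂ) * (2 * s + c)) := by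
    rw [cpow_def_of_ne_zero hninv, ← Complex.ofReal_log (norm_nonneg _), norm_inv, Real.log_inv, Complex.ofReal_neg]
  -- the right-hand side through `log z = log ‖z‖ + iθ`, `log (conj z) = conj (log z)`
  have hL : Complex.log z = ((Real.log ‖z‖ : ℝ) : ℂ) + (z.arg : ℂ) * I := by
    rw [← re_add_im (Complex.log z), log_re, log_im]
  have hLc : Complex.log (conj z) = ((Real.log ‖z‖ : ℝ) : ℂ) - (z.arg : ℂ) * I := by
    rw [log_conj z harg, hL, map_add, map_mul, Complex.conj_ofReal, Complex.conj_ofReal, conj_I, mul_neg, sub_eq_add_neg]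
  rw [h1, h2, ← exp_int_mul, ← Complex.exp_add, cpow_def_of_ne_zero hz, cpow_def_of_ne_zero hzc, ← Complex.exp_add, hL, hLc]
  congr 1
  ring

variable {l : Type*} [Fintype l] [DecidableEq l]

/-- `det(1 + ib) = conj det(1 − ib)` for hermitian `b`. [folklore] -/
theorem det_one_add_I_smul_eq_conj {b : Matrix l l ℂ} (hb : bᴴ = b) : (1 + I • b).det = conj (1 - I • b).det := by
  rw [← conjTranspose_one_sub_I_smul hb, det_conjTranspose, star_def]

/-- `det ((1 − ib)⁻¹) = (det(1 − ib))⁻¹`. [folklore] -/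
theorem det_inv_one_sub_I_smul (b : Matrix l l ℂ) : ((1 - I • b)⁻¹).det = ((1 - I • b).det)⁻¹ := by
  rw [det_nonsing_inv, Ring.inverse_eq_inv']

/-- **THE WEIGHT-`k` MODULUS IN `ξ`-LETTERS**: `χ_k(det a)·‖det a‖^{2s+l} = det(1 − ib)^{−(s + l∕2 − k∕2)}·det(1 + ib)^{−(s + l∕2 + k∕2)}`, `a = (1 − ib)⁻¹`,
for hermitian `b` with `arg det(1 − ib) ≠ π`. [cite: Shimura1997, §16.4] -/
theorem modulus_eq {b : Matrix l l ℂ} (hb : bᴴ = b) (harg : ((1 - I • b).det).arg ≠ Real.pi) (k : ℤ) (s : ℂ) :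
    (conj ((1 - I • b)⁻¹).det / ((‖((1 - I • b)⁻¹).det‖ : ℝ) : ℂ)) ^ k * (((‖((1 - I • b)⁻¹).det‖ : ℝ) : ℂ)) ^ (2 * s + (Fintype.card l : ℂ)) =
      (1 - I • b).det ^ (-(s + (Fintype.card l : ℂ) / 2 - k / 2)) * (1 + I • b).det ^ (-(s + (Fintype.card l : ℂ) / 2 + k / 2)) := by
  rw [det_inv_one_sub_I_smul, det_one_add_I_smul_eq_conj hb]
  exact conj_inv_div_norm_zpow_mul_norm_cpow (isUnit_det_one_sub_I_smul hb).ne_zero harg k s _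

/-! ## §2 `l = Fin 2`: `det(1 − ix)` is never negative real -/

/-- `det(1 − i·hermTwo(a, z, b)) = (1 − ab + |z|²) − i(a + b)`. [folklore] -/
theorem det_one_sub_I_smul_hermTwo (c : ℝ × ℂ × ℝ) :
    (1 - I • hermTwo c).det = ((1 - c.1 * c.2.2 + normSq c.2.1 : ℝ) : ℂ) - I * ((c.1 + c.2.2 : ℝ) : ℂ) := by
  rw [det_sub_I_smul_hermTwo]
  simp only [Matrix.one_apply_eq, Matrix.one_apply_ne (by decide : (0 : Fin 2) ≠ 1), Matrix.one_apply_ne (by decide : (1 : Fin 2) ≠ 0)]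
  push_cast
  rw [Complex.normSq_eq_conj_mul_self]
  linear_combination ((c.1 : ℂ) * (c.2.2 : ℂ) - c.2.1 * conj c.2.1) * I_mul_I

/-- **`arg det(1 − ix) ≠ π`** for every hermitian `2 × 2` matrix `x`: if the imaginary part `−(a + b)` vanishes the real part is `1 + a² + |z|² > 0`.
[folklore] -/
theorem arg_det_one_sub_I_smul_hermTwo_ne_pi (c : ℝ × ℂ × ℝ) : ((1 - I • hermTwo c).det).arg ≠ Real.pi := by
  rw [Ne, arg_eq_pi_iff, det_one_sub_I_smul_hermTwo, not_and]
  intro hre him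
  simp only [Complex.sub_re, Complex.sub_im, Complex.ofReal_re, Complex.ofReal_im, Complex.mul_re, Complex.mul_im, I_re, I_im, zero_mul,
    one_mul, mul_zero, sub_zero, zero_sub, zero_add] at hre him
  have hb : c.2.2 = -c.1 := by linarith
  rw [hb] at hre
  nlinarith [normSq_nonneg c.2.1, sq_nonneg c.1]

/-! ## §3 The moment expansion on `U(2,2)` -/

/-- **A `K_w`-FINITE WEIGHT-`k` SECTION AT THE WEYL TRANSLATE IS A FINITE SUM OF POLYNOMIAL MOMENTS OF `ξ`-INTEGRANDS.**  For a Siegel section `f` of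
`I_w(s, χ_k)` on `U(2,2)` (`χ_k(z) = (z̄∕‖z‖)^k`) whose restriction to `K_w` is polynomial in the entries and their conjugates, and every `h`: there are
finitely many `P_d ∈ ℂ[x_{jk}]`, `m_d, n_d ∈ ℕ` with
`f (J · transl x) · e(−tr(h x)) = Σ_d P_d(x) · xiTwoIntegrand 1 h (s + 1 − k∕2 + m_d) (s + 1 + k∕2 + n_d) c`, `x = hermTwo c`. [cite: Shimura1997, §16.4] -/
theorem exists_xiTwoIntegrand_moments (k : ℤ) (s : ℂ) {f : Matrix (Fin 2 ⊕ Fin 2) (Fin 2 ⊕ Fin 2) ℂ → ℂ}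
    (hf : K2LiuArchInducedTubeDefs.IsArchSiegelSection (fun z : ℂ => (conj z / ((‖z‖ : ℝ) : ℂ)) ^ k) s f)
    (hF2 : ∃ P : MvPolynomial (((Fin 2 ⊕ Fin 2) × (Fin 2 ⊕ Fin 2)) ⊕ ((Fin 2 ⊕ Fin 2) × (Fin 2 ⊕ Fin 2))) ℂ,
      ∀ u : Matrix (Fin 2 ⊕ Fin 2) (Fin 2 ⊕ Fin 2) ℂ, uᴴ * Matrix.J (Fin 2) ℂ * u = Matrix.J (Fin 2) ℂ → moeb u (I • (1 : Matrix (Fin 2) (Fin 2) ℂ)) = I • 1 →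
        f u = MvPolynomial.eval (Sum.elim (fun pq => u pq.1 pq.2) (fun pq => conj (u pq.1 pq.2))) P)
    (h : Matrix (Fin 2) (Fin 2) ℂ) :
    ∃ (ι : Finset (((Fin 2 × Fin 2) ⊕ (Fin 2 × Fin 2)) →₀ ℕ)) (P : (((Fin 2 × Fin 2) ⊕ (Fin 2 × Fin 2)) →₀ ℕ) → MvPolynomial (Fin 2 × Fin 2) ℂ)
      (m n : (((Fin 2 × Fin 2) ⊕ (Fin 2 × Fin 2)) →₀ ℕ) → ℕ),
      ∀ c : ℝ × ℂ × ℝ,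
        f (Matrix.J (Fin 2) ℂ * fromBlocks 1 (hermTwo c) 0 1) * cexp (-(2 * Real.pi * I) * (h * hermTwo c).trace) =
          ∑ d ∈ ι, MvPolynomial.eval (fun jk : Fin 2 × Fin 2 => hermTwo c jk.1 jk.2) (P d) *
            xiTwoIntegrand 1 h (s + 1 - k / 2 + m d) (s + 1 + k / 2 + n d) c := by
  obtain ⟨Q, hQ⟩ := exists_mvPolynomial_section_J_mul_transl hf hF2
  obtain ⟨P, m, n, hP⟩ := exists_cofactor_expansion Q
  refine ⟨Q.support, fun d => MvPolynomial.C (cexp (-((Real.pi * I) * ((s + 1 + k / 2 + n d) - (s + 1 - k / 2 + m d))))) * P d, m, n, fun c => ?_⟩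
  have hx : (hermTwo c)ᴴ = hermTwo c := (isHermitian_hermTwo c).eq
  have hcard : (Fintype.card (Fin 2) : ℂ) = 2 := by simp
  have h2 : s + 2 / 2 - (k : ℂ) / 2 = s + 1 - k / 2 := by ring
  have h2' : s + 2 / 2 + (k : ℂ) / 2 = s + 1 + k / 2 := by ring
  rw [hQ _ hx]
  beta_reduce
  rw [modulus_eq hx (arg_det_one_sub_I_smul_hermTwo_ne_pi c) k s, hcard, h2, h2',
    mul_comm ((1 - I • hermTwo c).det ^ (-(s + 1 - (k : ℂ) / 2)) * (1 + I • hermTwo c).det ^ (-(s + 1 + (k : ℂ) / 2))) (MvPolynomial.eval _ Q),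
    hP _ hx, Finset.sum_mul]
  refine Finset.sum_congr rfl fun d _ => ?_
  rw [xiTwoIntegrand_eq, map_mul, MvPolynomial.eval_C]
  have hE : cexp (-((Real.pi * I) * ((s + 1 + k / 2 + n d) - (s + 1 - k / 2 + m d)))) * cexp ((Real.pi * I) * ((s + 1 + k / 2 + n d) - (s + 1 - k / 2 + m d))) = 1 := by
    rw [← Complex.exp_add, neg_add_cancel, Complex.exp_zero]
  have hA : -(s + 1 - (k : ℂ) / 2 + (m d : ℕ)) = -(s + 1 - k / 2 + m d) := rfl
  calc MvPolynomial.eval (fun jk : Fin 2 × Fin 2 => hermTwo c jk.1 jk.2) (P d) *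
        ((1 - I • hermTwo c).det ^ (-(s + 1 - (k : ℂ) / 2 + (m d : ℕ))) * (1 + I • hermTwo c).det ^ (-(s + 1 + (k : ℂ) / 2 + (n d : ℕ)))) *
          cexp (-(2 * Real.pi * I) * (h * hermTwo c).trace)
        = MvPolynomial.eval (fun jk : Fin 2 × Fin 2 => hermTwo c jk.1 jk.2) (P d) *
          (cexp (-((Real.pi * I) * ((s + 1 + k / 2 + n d) - (s + 1 - k / 2 + m d)))) * cexp ((Real.pi * I) * ((s + 1 + k / 2 + n d) - (s + 1 - k / 2 + m d)))) *
            (cexp (-(2 * Real.pi * I) * (h * hermTwo c).trace) *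
              ((1 - I • hermTwo c).det ^ (-(s + 1 - (k : ℂ) / 2 + (m d : ℕ))) * (1 + I • hermTwo c).det ^ (-(s + 1 + (k : ℂ) / 2 + (n d : ℕ))))) := by
          rw [hE]; ring
    _ = _ := by ring

end Summit.HodgeConjecture.HodgeConjecture.Cruxes.HLiu418.K2LiuKFiniteSectionXiIntegrandMoments

end
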